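import Literature.Barriers.CriticalPhenomena.WeaklySAWPerturbativeCoefficients
import Literature.Barriers.CriticalPhenomena.WeaklySAWPerturbativeBetaBounds
import HarnessLib

/-!
# BBS 2015, §6.1: the coefficients `β_j, θ_j, η_j, ξ_j, π_j` of `φ̄` depend continuously on `m²`

Companion of `WeaklySAWPerturbativeCoefficients.lean` (the definitions `etaPT`, `thetaPT`, `xiPT`,
`piPT`, `omegaPT`, `wsawQuadFlow`) and `WeaklySAWPerturbativeBetaBounds.lean`
(`continuousWithinAt_covSum_mass`, `continuousWithinAt_betaPT_mass`). Source: Bauerschmidt–Brydges–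
Slade, CMP 337 (2015) [BBS2015], §6.1: "`β_j, θ_j, η_j, ξ_j, π_j` are real coefficients defined
precisely in [BBS-rg-pt]. These coefficients, and hence also `φ̄`, depend continuously on the mass
`m²` (see [BBS-rg-pt, Proposition 4.4])" — in the arXiv numbering of [BBS-rg-pt] (arXiv:1403.7252)
this is Proposition 4.2.2, first sentence: "Let `d = 4` … Each coefficient in (newflow-gbar)–
(newflow-mubar) is a continuous function of `m² ∈ [0, δ)`" ("continuity … follows from
Proposition 6.1.1(a)", the continuity of each `C_{j;0,x}` in `m²`, which for the explicit
decomposition of this tree is `LongRangePhi4.FRD.continuousWithinAt_Gam_mass`). This continuity is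
the input of BBS 2015 §8 (Proposition 8.1/8.2: the flow and the critical initial conditions
`ν₀ᶜ(m²), z₀ᶜ(m²)` are continuous in `m²`).

## What this file provides (all statements proved; no definitions, no named facts)

For `d ≥ 1`, `L ≥ 1`, every scale `j` and every `m₀² ≥ 0` (continuity WITHIN `[0,∞)`, so the
critical value `m² = 0` is included):

* `continuousWithinAt_lapl_covSum_mass` (`m² ↦ (Δw_j)_x`), `powSum_covSum_eq_sum`,
  `continuousWithinAt_powSum_covSum_mass` (`m² ↦ w_j^{(n)}`), `continuousWithinAt_starSum_covSum_pow_mass`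
  (`m² ↦ (w_jⁿ)^{(**)}`), `continuousWithinAt_tsum_mul_lapl_covSum_mass` (`m² ↦ (w_jΔw_j)^{(1)}`) —
  each via the finite-range reduction to a finite sum over `|x|₁ < ½L^j`;
* **`continuousWithinAt_etaPT_mass`, `continuousWithinAt_thetaPT_mass`, `continuousWithinAt_xiPT_mass`,
  `continuousWithinAt_piPT_mass`, `continuousWithinAt_omegaPT_mass`** (and the primed versions) —
  the printed statement for each coefficient of `φ̄`;
* `tendsto_thetaPT_mass`, `tendsto_etaPT_mass`, `tendsto_xiPT_mass`, `tendsto_piPT_mass` — the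
  critical coefficients are the limits `m² ↓ 0` of the massive ones;
* **`continuousWithinAt_wsawQuadFlow_map_mass`** — "and hence also `φ̄`": every component of
  `φ̄_j(V)` is continuous in `m² ∈ [0,∞)` for fixed `j`, `V`.
-/

noncomputable section

open Set Filter Topology
open Literature.Probability.LatticeModels
open scoped BigOperators

namespace Literature.Barriers.CriticalPhenomena

namespace CTWSAW

open LongRangePhi4 LongRangePhi4.FRD PT

variable {d : ℕ}

/-! ### Finite-range building blocks -/

/-- `m² ↦ (Δw_j)_x(m²)` is continuous on `[0,∞)` (`d ≥ 1`, `L ≥ 0`).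
[cite: BauerschmidtBrydgesSlade2015LogCorr, §6.1 ("depend continuously on the mass m²"; [BBS-rg-pt] Proposition 6.1.1(a))] -/
theorem continuousWithinAt_lapl_covSum_mass (hd : 1 ≤ d) {L : ℝ} (hL : 0 ≤ L) (j : ℕ) (x : Site d)
    {s₀ : ℝ} (hs₀ : 0 ≤ s₀) :
    ContinuousWithinAt (fun s => lapl (covSum d L s j) x) (Ici 0) s₀ := by
  unfold lapl
  exact tendsto_finsetSum _ fun i _ =>
    (((continuousWithinAt_covSum_mass hd hL j _ hs₀).add
      (continuousWithinAt_covSum_mass hd hL j _ hs₀)).sub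
      (continuousWithinAt_const.mul (continuousWithinAt_covSum_mass hd hL j x hs₀))).tendsto

/-- `w_j^{(n)} = Σ_{|x|₁<½L^j}w_{j,x}ⁿ` (`n ≠ 0`; finite range). [cite: BauerschmidtBrydgesSlade2015LogCorr, §5.1 (finite range)] -/
theorem powSum_covSum_eq_sum (hd : 1 ≤ d) {L : ℝ} (hL : 1 ≤ L) {s : ℝ} (hs : 0 ≤ s) (j : ℕ)
    {n : ℕ} (hn : n ≠ 0) :
    powSum (covSum d L s j) n = ∑ x ∈ PT.ball (L ^ j / 2), covSum d L s j x ^ n :=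
  powSum_eq_sum (fun x hx => by
    rw [PT.mem_ball, not_lt] at hx
    exact covSum_eq_zero hd hL hs hx) hn

/-- `m² ↦ w_j^{(n)}(m²)` is continuous on `[0,∞)` (`n ≠ 0`, `d ≥ 1`, `L ≥ 1`).
[cite: BauerschmidtBrydgesSlade2015LogCorr, §6.1 ("depend continuously on the mass m²"; [BBS-rg-pt] Proposition 6.1.1(a))] -/
theorem continuousWithinAt_powSum_covSum_mass (hd : 1 ≤ d) {L : ℝ} (hL : 1 ≤ L) (j : ℕ) {n : ℕ}
    (hn : n ≠ 0) {s₀ : ℝ} (hs₀ : 0 ≤ s₀) :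
    ContinuousWithinAt (fun s => powSum (covSum d L s j) n) (Ici 0) s₀ := by
  have hL0 : 0 ≤ L := zero_le_one.trans hL
  have hf : ContinuousWithinAt (fun s => ∑ x ∈ PT.ball (L ^ j / 2), covSum d L s j x ^ n)
      (Ici 0) s₀ :=
    tendsto_finsetSum _ fun x _ => ((continuousWithinAt_covSum_mass hd hL0 j x hs₀).pow n).tendsto
  exact hf.congr (fun s hs => powSum_covSum_eq_sum hd hL hs j hn)
    (powSum_covSum_eq_sum hd hL hs₀ j hn)

/-- `m² ↦ (w_jⁿ)^{(**)}(m²)` is continuous on `[0,∞)` (`n ≠ 0`, `d ≥ 1`, `L ≥ 1`).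
[cite: BauerschmidtBrydgesSlade2015LogCorr, §6.1 ("depend continuously on the mass m²"; [BBS-rg-pt] Proposition 6.1.1(a))] -/
theorem continuousWithinAt_starSum_covSum_pow_mass (hd : 1 ≤ d) {L : ℝ} (hL : 1 ≤ L) (j : ℕ)
    {n : ℕ} (hn : n ≠ 0) {s₀ : ℝ} (hs₀ : 0 ≤ s₀) :
    ContinuousWithinAt (fun s => starSum (fun x => covSum d L s j x ^ n)) (Ici 0) s₀ := by
  have hL0 : 0 ≤ L := zero_le_one.trans hL
  have hf : ContinuousWithinAt (fun s =>
      (∑ x ∈ PT.ball (L ^ j / 2), (∑ i, ((x i : ℤ) : ℝ) ^ 2) * covSum d L s j x ^ n) / d)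
      (Ici 0) s₀ := by
    refine ContinuousWithinAt.div_const ?_ _
    exact tendsto_finsetSum _ fun x _ =>
      (continuousWithinAt_const.mul ((continuousWithinAt_covSum_mass hd hL0 j x hs₀).pow n)).tendsto
  exact hf.congr (fun s hs => starSum_covSum_pow_eq_sum hd hL hs j hn)
    (starSum_covSum_pow_eq_sum hd hL hs₀ j hn)

/-- `m² ↦ (w_jΔw_j)^{(1)}(m²) = Σ_xw_{j,x}(Δw_j)_x` is continuous on `[0,∞)` (`d ≥ 1`, `L ≥ 1`).
[cite: BauerschmidtBrydgesSlade2015LogCorr, §6.1 ("depend continuously on the mass m²"; [BBS-rg-pt] Proposition 6.1.1(a))] -/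
theorem continuousWithinAt_tsum_mul_lapl_covSum_mass (hd : 1 ≤ d) {L : ℝ} (hL : 1 ≤ L) (j : ℕ)
    {s₀ : ℝ} (hs₀ : 0 ≤ s₀) :
    ContinuousWithinAt (fun s => ∑' x : Site d, covSum d L s j x * lapl (covSum d L s j) x)
      (Ici 0) s₀ := by
  have hL0 : 0 ≤ L := zero_le_one.trans hL
  have hf : ContinuousWithinAt (fun s =>
      ∑ x ∈ PT.ball (L ^ j / 2), covSum d L s j x * lapl (covSum d L s j) x) (Ici 0) s₀ :=
    tendsto_finsetSum _ fun x _ =>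
      ((continuousWithinAt_covSum_mass hd hL0 j x hs₀).mul
        (continuousWithinAt_lapl_covSum_mass hd hL0 j x hs₀)).tendsto
  exact hf.congr (fun s hs => tsum_mul_lapl_covSum_eq_sum hd hL hs j)
    (tsum_mul_lapl_covSum_eq_sum hd hL hs₀ j)

/-! ### The coefficients of `φ̄` are continuous in `m² ∈ [0,∞)` -/

/-- **`m² ↦ η'_j(m²) = 2C_{j+1;0,0}(m²)` is continuous on `[0,∞)`** (`d ≥ 1`, `L ≥ 0`).
[cite: BauerschmidtBrydgesSlade2015LogCorr, §6.1 ("These coefficients … depend continuously on the mass m² (see [BBS-rg-pt, Proposition 4.4])")] -/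
theorem continuousWithinAt_etaPrimePT_mass (hd : 1 ≤ d) {L : ℝ} (hL : 0 ≤ L) (j : ℕ) {s₀ : ℝ}
    (hs₀ : 0 ≤ s₀) : ContinuousWithinAt (fun s => etaPrimePT d L s j) (Ici 0) s₀ :=
  continuousWithinAt_const.mul (continuousWithinAt_Gam_mass hd hL (j + 1) 0 hs₀)

/-- **`m² ↦ η_j(m²)` is continuous on `[0,∞)`** (`d ≥ 1`, `L ≥ 0`).
[cite: BauerschmidtBrydgesSlade2015LogCorr, §6.1 ("These coefficients … depend continuously on the mass m²")] -/
theorem continuousWithinAt_etaPT_mass (hd : 1 ≤ d) {L : ℝ} (hL : 0 ≤ L) (j : ℕ) {s₀ : ℝ}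
    (hs₀ : 0 ≤ s₀) : ContinuousWithinAt (fun s => etaPT d L s j) (Ici 0) s₀ :=
  continuousWithinAt_const.mul (continuousWithinAt_etaPrimePT_mass hd hL j hs₀)

/-- **`m² ↦ θ_j(m²)` is continuous on `[0,∞)`** (`d ≥ 1`, `L ≥ 1`).
[cite: BauerschmidtBrydgesSlade2015LogCorr, §6.1 ("These coefficients … depend continuously on the mass m²")] -/
theorem continuousWithinAt_thetaPT_mass (hd : 1 ≤ d) {L : ℝ} (hL : 1 ≤ L) (j : ℕ) {s₀ : ℝ}
    (hs₀ : 0 ≤ s₀) : ContinuousWithinAt (fun s => thetaPT d L s j) (Ici 0) s₀ := by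
  unfold thetaPT
  exact continuousWithinAt_const.mul
    ((continuousWithinAt_starSum_covSum_pow_mass hd hL (j + 1) three_ne_zero hs₀).sub
      (continuousWithinAt_starSum_covSum_pow_mass hd hL j three_ne_zero hs₀))

/-- **`m² ↦ ξ'_j(m²)` is continuous on `[0,∞)`** (`d ≥ 1`, `L ≥ 1`).
[cite: BauerschmidtBrydgesSlade2015LogCorr, §6.1 ("These coefficients … depend continuously on the mass m²")] -/
theorem continuousWithinAt_xiPrimePT_mass (hd : 1 ≤ d) {L : ℝ} (hL : 1 ≤ L) (j : ℕ) {s₀ : ℝ}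
    (hs₀ : 0 ≤ s₀) : ContinuousWithinAt (fun s => xiPrimePT d L s j) (Ici 0) s₀ := by
  have hL0 : 0 ≤ L := zero_le_one.trans hL
  unfold xiPrimePT
  refine (continuousWithinAt_const.mul
    (((continuousWithinAt_powSum_covSum_mass hd hL (j + 1) three_ne_zero hs₀).sub
      (continuousWithinAt_powSum_covSum_mass hd hL j three_ne_zero hs₀)).sub
      ((continuousWithinAt_const.mul
        (continuousWithinAt_powSum_covSum_mass hd hL j two_ne_zero hs₀)).mul
        (continuousWithinAt_Gam_mass hd hL0 (j + 1) 0 hs₀)))).add ?_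
  exact (continuousWithinAt_const.mul (continuousWithinAt_betaPT_mass hd hL j hs₀)).mul
    (continuousWithinAt_etaPrimePT_mass hd hL0 j hs₀)

/-- **`m² ↦ ξ_j(m²)` is continuous on `[0,∞)`** (`d ≥ 1`, `L ≥ 1`).
[cite: BauerschmidtBrydgesSlade2015LogCorr, §6.1 ("These coefficients … depend continuously on the mass m²")] -/
theorem continuousWithinAt_xiPT_mass (hd : 1 ≤ d) {L : ℝ} (hL : 1 ≤ L) (j : ℕ) {s₀ : ℝ}
    (hs₀ : 0 ≤ s₀) : ContinuousWithinAt (fun s => xiPT d L s j) (Ici 0) s₀ :=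
  continuousWithinAt_const.mul (continuousWithinAt_xiPrimePT_mass hd hL j hs₀)

/-- **`m² ↦ π'_j(m²)` is continuous on `[0,∞)`** (`d ≥ 1`, `L ≥ 1`).
[cite: BauerschmidtBrydgesSlade2015LogCorr, §6.1 ("These coefficients … depend continuously on the mass m²")] -/
theorem continuousWithinAt_piPrimePT_mass (hd : 1 ≤ d) {L : ℝ} (hL : 1 ≤ L) (j : ℕ) {s₀ : ℝ}
    (hs₀ : 0 ≤ s₀) : ContinuousWithinAt (fun s => piPrimePT d L s j) (Ici 0) s₀ := by
  unfold piPrimePT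
  exact continuousWithinAt_const.mul
    ((continuousWithinAt_tsum_mul_lapl_covSum_mass hd hL (j + 1) hs₀).sub
      (continuousWithinAt_tsum_mul_lapl_covSum_mass hd hL j hs₀))

/-- **`m² ↦ π_j(m²)` is continuous on `[0,∞)`** (`d ≥ 1`, `L ≥ 1`).
[cite: BauerschmidtBrydgesSlade2015LogCorr, §6.1 ("These coefficients … depend continuously on the mass m²")] -/
theorem continuousWithinAt_piPT_mass (hd : 1 ≤ d) {L : ℝ} (hL : 1 ≤ L) (j : ℕ) {s₀ : ℝ}
    (hs₀ : 0 ≤ s₀) : ContinuousWithinAt (fun s => piPT d L s j) (Ici 0) s₀ :=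
  continuousWithinAt_const.mul (continuousWithinAt_piPrimePT_mass hd hL j hs₀)

/-- **`m² ↦ ω_j(m²) = L²¼β_j(m²)` is continuous on `[0,∞)`** (`d ≥ 1`, `L ≥ 1`).
[cite: BauerschmidtBrydgesSlade2015LogCorr, §6.1 ("These coefficients … depend continuously on the mass m²")] -/
theorem continuousWithinAt_omegaPT_mass (hd : 1 ≤ d) {L : ℝ} (hL : 1 ≤ L) (j : ℕ) {s₀ : ℝ}
    (hs₀ : 0 ≤ s₀) : ContinuousWithinAt (fun s => omegaPT d L s j) (Ici 0) s₀ :=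
  continuousWithinAt_const.mul (continuousWithinAt_betaPT_mass hd hL j hs₀)

/-! ### The critical coefficients as limits `m² ↓ 0` -/

/-- `θ_j(m²) → θ_j(0)` as `m² ↓ 0`. [cite: BauerschmidtBrydgesSlade2015LogCorr, §6.1 ("depend continuously on the mass m²") and §5.1 ("m² = 0 corresponds to ν = ν_c")] -/
theorem tendsto_thetaPT_mass (hd : 1 ≤ d) {L : ℝ} (hL : 1 ≤ L) (j : ℕ) :
    Tendsto (fun s => thetaPT d L s j) (𝓝[>] 0) (𝓝 (thetaPT d L 0 j)) :=
  ((continuousWithinAt_thetaPT_mass hd hL j le_rfl).tendsto).mono_left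
    (nhdsWithin_mono _ Ioi_subset_Ici_self)

/-- `η_j(m²) → η_j(0)` as `m² ↓ 0`. [cite: BauerschmidtBrydgesSlade2015LogCorr, §6.1 ("depend continuously on the mass m²") and §5.1 ("m² = 0 corresponds to ν = ν_c")] -/
theorem tendsto_etaPT_mass (hd : 1 ≤ d) {L : ℝ} (hL : 0 ≤ L) (j : ℕ) :
    Tendsto (fun s => etaPT d L s j) (𝓝[>] 0) (𝓝 (etaPT d L 0 j)) :=
  ((continuousWithinAt_etaPT_mass hd hL j le_rfl).tendsto).mono_left
    (nhdsWithin_mono _ Ioi_subset_Ici_self)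

/-- `ξ_j(m²) → ξ_j(0)` as `m² ↓ 0`. [cite: BauerschmidtBrydgesSlade2015LogCorr, §6.1 ("depend continuously on the mass m²") and §5.1 ("m² = 0 corresponds to ν = ν_c")] -/
theorem tendsto_xiPT_mass (hd : 1 ≤ d) {L : ℝ} (hL : 1 ≤ L) (j : ℕ) :
    Tendsto (fun s => xiPT d L s j) (𝓝[>] 0) (𝓝 (xiPT d L 0 j)) :=
  ((continuousWithinAt_xiPT_mass hd hL j le_rfl).tendsto).mono_left
    (nhdsWithin_mono _ Ioi_subset_Ici_self)

/-- `π_j(m²) → π_j(0)` as `m² ↓ 0`. [cite: BauerschmidtBrydgesSlade2015LogCorr, §6.1 ("depend continuously on the mass m²") and §5.1 ("m² = 0 corresponds to ν = ν_c")] -/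
theorem tendsto_piPT_mass (hd : 1 ≤ d) {L : ℝ} (hL : 1 ≤ L) (j : ℕ) :
    Tendsto (fun s => piPT d L s j) (𝓝[>] 0) (𝓝 (piPT d L 0 j)) :=
  ((continuousWithinAt_piPT_mass hd hL j le_rfl).tendsto).mono_left
    (nhdsWithin_mono _ Ioi_subset_Ici_self)

/-! ### "and hence also `φ̄`" -/

/-- **`φ̄` depends continuously on `m²`**: for fixed `j` and `V = (ḡ, z̄, μ̄)`, every component of
`φ̄_j(V)` (the flow `wsawQuadFlow L m²` of BBS 2015 §6.1, `d = 4`) is a continuous function of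
`m² ∈ [0,∞)` (`L ≥ 1`). [cite: BauerschmidtBrydgesSlade2015LogCorr, §6.1 ("These coefficients, and hence also φ̄, depend continuously on the mass m²")] -/
theorem continuousWithinAt_wsawQuadFlow_map_mass {L : ℝ} (hL : 1 ≤ L) (j : ℕ) (V : V3) (i : Fin 3)
    {s₀ : ℝ} (hs₀ : 0 ≤ s₀) :
    ContinuousWithinAt (fun s => (wsawQuadFlow L s).map j V i) (Ici 0) s₀ := by
  have hd : 1 ≤ 4 := by norm_num
  have hL0 : 0 ≤ L := zero_le_one.trans hL
  fin_cases i
  · simp only [Fin.zero_eta, wsawQuadFlow_map_zero]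
    exact continuousWithinAt_const.sub
      ((continuousWithinAt_betaPT_mass hd hL j hs₀).mul continuousWithinAt_const)
  · simp only [Fin.mk_one, wsawQuadFlow_map_one]
    exact continuousWithinAt_const.sub
      ((continuousWithinAt_thetaPT_mass hd hL j hs₀).mul continuousWithinAt_const)
  · simp only [Fin.reduceFinMk, wsawQuadFlow_map_two]
    refine ((ContinuousWithinAt.add ?_ ?_).sub ?_).sub ?_
    · exact continuousWithinAt_const.mul (continuousWithinAt_const.sub
        ((continuousWithinAt_const.mul (continuousWithinAt_betaPT_mass hd hL j hs₀)).mul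
          continuousWithinAt_const))
    · exact (continuousWithinAt_etaPT_mass hd hL0 j hs₀).mul continuousWithinAt_const
    · exact (continuousWithinAt_xiPT_mass hd hL j hs₀).mul continuousWithinAt_const
    · exact ((continuousWithinAt_piPT_mass hd hL j hs₀).mul continuousWithinAt_const).mul
        continuousWithinAt_const

end CTWSAW

end Literature.Barriers.CriticalPhenomena
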